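import Literature.MeasureTheory.Lebesgue.LipschitzShearSubstitution
import Mathlib.Analysis.InnerProductSpace.PiL2
import Mathlib.MeasureTheory.Measure.Haar.InnerProductSpace
import Mathlib.MeasureTheory.Constructions.BorelSpace.Order
import HarnessLib

/-!
# Inverting a shear along `e₁` on each line: the root function (Richthammer 2007, §6.5)

Part of the bottom-up programme for `Richthammer2007_ineq35` (the target cells `Ã_π` of
`ShearCells.Admissible` come from the INVERSE construction of §6.5). Richthammer inverts the
transformations `T^k = id + t^k e₁` along each line `z + ℝ e₁` ("`T^k` is `e`-continuous and
`≤_e`-increasing, and hence bijective", (6.3)) and works with the compositions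
`t^k ∘ (T^k)⁻¹`, characterised by `(T^k)⁻¹ + t^k ∘ (T^k)⁻¹ e₁ = id` (6.12) and by the
monotonicity `t̃^k ∘ (T̃^k)⁻¹(x) ≥ c ⇔ t̃^k(x - c e₁) ≥ c` (6.27). For a function `f : ℝ² → ℝ` that
is `L`-Lipschitz along `e₁` with `L < 1` and a sign `σ` with `|σ| ≤ 1` (forward `σ = 1`,
backward `σ = -1`) this file defines and studies

* `lineRoot σ f z` — the unique `c` with `f(z - σ c e₁) = c`, i.e. `c = f ∘ (id + σ f e₁)⁻¹ (z)`
  and `z - σ c e₁ = (id + σ f e₁)⁻¹(z)` (`existsUnique_lineRoot`, `lineRoot_spec`);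
* `lineRoot_shear` — (6.12): `lineRoot σ f (y + σ f(y) e₁) = f(y)`;
* `le_lineRoot_iff`, `lineRoot_lt_iff` — (6.27): `c ≤ lineRoot σ f z ⇔ c ≤ f(z - σ c e₁)`;
* `measurable_lineRoot` — joint measurability in `(parameters, z)` from (6.27) ("the only
  difficulty is to show that the functions `(T̃^k)⁻¹(x)` are measurable, which follows from the
  `e`-monotonicity", §6.5 p. 15).

## References

* [Richthammer2007] T. Richthammer, *Translation-invariance of two-dimensional Gibbsian point
  processes*, Comm. Math. Phys. 274 (2007) 81–122, arXiv:0706.3637: §6.3 (6.3) (p. 13), §6.5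
  (6.12), (6.27) (pp. 14–15).
-/

noncomputable section

open MeasureTheory Set Function Filter
open scoped ENNReal NNReal Topology

namespace Literature.Barriers.AtomisticToContinuum.HardDisk

open Literature.MeasureTheory.Lebesgue

/-! ### Existence and uniqueness of the root -/

/-- The function `c ↦ -f(z - σ c e₁)` is `L`-Lipschitz when `f` is `L`-Lipschitz along `e₁` and
`|σ| ≤ 1`. [folklore] -/
theorem lipschitz_neg_comp_line {L : ℝ≥0} {f : EuclideanSpace ℝ (Fin 2) → ℝ}
    (hf : ∀ p, LipschitzWith L fun r : ℝ => f (p + r • EuclideanSpace.single 0 (1 : ℝ)))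
    {σ : ℝ} (hσ : |σ| ≤ 1) (z : EuclideanSpace ℝ (Fin 2)) :
    LipschitzWith L fun c : ℝ => -f (z - (σ * c) • EuclideanSpace.single 0 (1 : ℝ)) := by
  refine LipschitzWith.of_dist_le_mul fun c c' => ?_
  have h := (hf z).dist_le_mul (-(σ * c)) (-(σ * c'))
  rw [Real.dist_eq, Real.dist_eq] at h ⊢
  have e1 : z + -(σ * c) • EuclideanSpace.single 0 (1 : ℝ) = z - (σ * c) • EuclideanSpace.single 0 1 := by
    rw [neg_smul, sub_eq_add_neg]
  have e2 : z + -(σ * c') • EuclideanSpace.single 0 (1 : ℝ) = z - (σ * c') • EuclideanSpace.single 0 1 := by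
    rw [neg_smul, sub_eq_add_neg]
  rw [e1, e2] at h
  have hσc : |-(σ * c) - -(σ * c')| ≤ |c - c'| := by
    rw [show -(σ * c) - -(σ * c') = σ * (c' - c) by ring, abs_mul, abs_sub_comm c' c]
    calc |σ| * |c - c'| ≤ 1 * |c - c'| := mul_le_mul_of_nonneg_right hσ (abs_nonneg _)
      _ = |c - c'| := one_mul _
  calc |-f (z - (σ * c) • EuclideanSpace.single 0 1) - -f (z - (σ * c') • EuclideanSpace.single 0 1)|
      = |f (z - (σ * c) • EuclideanSpace.single 0 1) - f (z - (σ * c') • EuclideanSpace.single 0 1)| := by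
        rw [show -f (z - (σ * c) • EuclideanSpace.single 0 1) - -f (z - (σ * c') • EuclideanSpace.single 0 1)
          = -(f (z - (σ * c) • EuclideanSpace.single 0 1) - f (z - (σ * c') • EuclideanSpace.single 0 1)) by ring,
          abs_neg]
    _ ≤ L * |-(σ * c) - -(σ * c')| := h
    _ ≤ L * |c - c'| := mul_le_mul_of_nonneg_left hσc L.2

/-- **Existence and uniqueness of the root** `c` of `f(z - σ c e₁) = c` for `f` `L`-Lipschitz
along `e₁`, `L < 1`, `|σ| ≤ 1` (the map `c ↦ c - f(z - σ c e₁)` is a strictly increasing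
bijection of `ℝ`). [cite: Richthammer2007, §6.3 (6.3) and §6.5 (6.12) (pp. 13–14)] -/
theorem existsUnique_lineRoot {L : ℝ≥0} (hL : L < 1) {f : EuclideanSpace ℝ (Fin 2) → ℝ}
    (hf : ∀ p, LipschitzWith L fun r : ℝ => f (p + r • EuclideanSpace.single 0 (1 : ℝ)))
    {σ : ℝ} (hσ : |σ| ≤ 1) (z : EuclideanSpace ℝ (Fin 2)) :
    ∃! c : ℝ, f (z - (σ * c) • EuclideanSpace.single 0 (1 : ℝ)) = c := by
  have ht := lipschitz_neg_comp_line hf hσ z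
  have hmono := strictMono_id_add ht hL
  have hsurj := surjective_id_add ht hL
  obtain ⟨c, hc⟩ := hsurj 0
  beta_reduce at hc
  refine ⟨c, by linarith, fun c' hc' => ?_⟩
  beta_reduce at hc'
  apply hmono.injective
  beta_reduce
  rw [hc', hc]
  ring

open Classical in
/-- **The root function** `lineRoot σ f z`: the unique `c` with `f(z - σ c e₁) = c` when it
exists uniquely (so `z - σ c e₁ = (id + σ f e₁)⁻¹(z)` and `c = f((id + σ f e₁)⁻¹(z))`), and `0`
otherwise. [cite: Richthammer2007, §6.5 (6.12) (p. 14)] -/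
def lineRoot (σ : ℝ) (f : EuclideanSpace ℝ (Fin 2) → ℝ) (z : EuclideanSpace ℝ (Fin 2)) : ℝ :=
  if h : ∃! c : ℝ, f (z - (σ * c) • EuclideanSpace.single 0 (1 : ℝ)) = c then Classical.choose h.exists
  else 0

/-- The defining equation of the root. [cite: Richthammer2007, §6.5 (6.12) (p. 14)] -/
theorem lineRoot_spec {L : ℝ≥0} (hL : L < 1) {f : EuclideanSpace ℝ (Fin 2) → ℝ}
    (hf : ∀ p, LipschitzWith L fun r : ℝ => f (p + r • EuclideanSpace.single 0 (1 : ℝ)))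
    {σ : ℝ} (hσ : |σ| ≤ 1) (z : EuclideanSpace ℝ (Fin 2)) :
    f (z - (σ * lineRoot σ f z) • EuclideanSpace.single 0 (1 : ℝ)) = lineRoot σ f z := by
  classical
  have h := existsUnique_lineRoot hL hf hσ z
  unfold lineRoot
  rw [dif_pos h]
  exact Classical.choose_spec h.exists

/-- Any solution of the equation is the root. [folklore] -/
theorem lineRoot_eq_of_eq {L : ℝ≥0} (hL : L < 1) {f : EuclideanSpace ℝ (Fin 2) → ℝ}
    (hf : ∀ p, LipschitzWith L fun r : ℝ => f (p + r • EuclideanSpace.single 0 (1 : ℝ)))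
    {σ : ℝ} (hσ : |σ| ≤ 1) {z : EuclideanSpace ℝ (Fin 2)} {c : ℝ}
    (hc : f (z - (σ * c) • EuclideanSpace.single 0 (1 : ℝ)) = c) : lineRoot σ f z = c :=
  (existsUnique_lineRoot hL hf hσ z).unique (lineRoot_spec hL hf hσ z) hc

/-- **(6.12): the root at an image point of the shear is the translation distance**:
`lineRoot σ f (y + σ f(y) e₁) = f(y)`, i.e. `f ∘ (id + σ f e₁)⁻¹ ∘ (id + σ f e₁) = f`.
[cite: Richthammer2007, §6.5 (6.12) (p. 14)] -/
theorem lineRoot_shear {L : ℝ≥0} (hL : L < 1) {f : EuclideanSpace ℝ (Fin 2) → ℝ}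
    (hf : ∀ p, LipschitzWith L fun r : ℝ => f (p + r • EuclideanSpace.single 0 (1 : ℝ)))
    {σ : ℝ} (hσ : |σ| ≤ 1) (y : EuclideanSpace ℝ (Fin 2)) :
    lineRoot σ f (y + (σ * f y) • EuclideanSpace.single 0 (1 : ℝ)) = f y :=
  lineRoot_eq_of_eq hL hf hσ (by rw [add_sub_cancel_right])

/-- **(6.27): monotone characterisation of the root**: `c ≤ lineRoot σ f z ⇔ c ≤ f(z - σ c e₁)`
(the function `c ↦ f(z - σ c e₁) - c` is strictly decreasing). [cite: Richthammer2007, §6.5 (6.27) (p. 15)] -/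
theorem le_lineRoot_iff {L : ℝ≥0} (hL : L < 1) {f : EuclideanSpace ℝ (Fin 2) → ℝ}
    (hf : ∀ p, LipschitzWith L fun r : ℝ => f (p + r • EuclideanSpace.single 0 (1 : ℝ)))
    {σ : ℝ} (hσ : |σ| ≤ 1) (z : EuclideanSpace ℝ (Fin 2)) (c : ℝ) :
    c ≤ lineRoot σ f z ↔ c ≤ f (z - (σ * c) • EuclideanSpace.single 0 (1 : ℝ)) := by
  have hmono := strictMono_id_add (lipschitz_neg_comp_line hf hσ z) hL
  have hroot := lineRoot_spec hL hf hσ z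
  -- `F c := c - f(z - σ c e₁)` is strictly increasing and vanishes at the root
  have key : c ≤ lineRoot σ f z ↔
      c + -f (z - (σ * c) • EuclideanSpace.single 0 (1 : ℝ)) ≤
        lineRoot σ f z + -f (z - (σ * lineRoot σ f z) • EuclideanSpace.single 0 (1 : ℝ)) :=
    hmono.le_iff_le.symm
  rw [key, hroot]
  constructor <;> intro h <;> linarith

/-- (6.27), strict version: `lineRoot σ f z < c ⇔ f(z - σ c e₁) < c`. [cite: Richthammer2007, §6.5 (6.27) (p. 15)] -/
theorem lineRoot_lt_iff {L : ℝ≥0} (hL : L < 1) {f : EuclideanSpace ℝ (Fin 2) → ℝ}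
    (hf : ∀ p, LipschitzWith L fun r : ℝ => f (p + r • EuclideanSpace.single 0 (1 : ℝ)))
    {σ : ℝ} (hσ : |σ| ≤ 1) (z : EuclideanSpace ℝ (Fin 2)) (c : ℝ) :
    lineRoot σ f z < c ↔ f (z - (σ * c) • EuclideanSpace.single 0 (1 : ℝ)) < c := by
  rw [← not_le, le_lineRoot_iff hL hf hσ, not_le]

/-! ### Measurability -/

/-- **Joint measurability of the root** in parameters and point: for `f : α → (ℝ² → ℝ)` jointly
measurable with every `f a` `L`-Lipschitz along `e₁` (`L < 1`), `(a, z) ↦ lineRoot σ (f a) z` is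
measurable — by (6.27) its superlevel sets are the measurable sets `{c ≤ f a (z - σ c e₁)}`.
[cite: Richthammer2007, §6.5 (p. 15, "follows from the `e`-monotonicity")] -/
theorem measurable_lineRoot {α : Type*} [MeasurableSpace α] {L : ℝ≥0} (hL : L < 1)
    {f : α → EuclideanSpace ℝ (Fin 2) → ℝ} (hm : Measurable fun p : α × EuclideanSpace ℝ (Fin 2) => f p.1 p.2)
    (hf : ∀ a p, LipschitzWith L fun r : ℝ => f a (p + r • EuclideanSpace.single 0 (1 : ℝ)))
    {σ : ℝ} (hσ : |σ| ≤ 1) :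
    Measurable fun p : α × EuclideanSpace ℝ (Fin 2) => lineRoot σ (f p.1) p.2 := by
  refine measurable_of_Ici fun c => ?_
  have hset : (fun p : α × EuclideanSpace ℝ (Fin 2) => lineRoot σ (f p.1) p.2) ⁻¹' Ici c =
      {p | c ≤ f p.1 (p.2 - (σ * c) • EuclideanSpace.single 0 (1 : ℝ))} := by
    ext p
    simp only [mem_preimage, mem_Ici, mem_setOf_eq]
    exact le_lineRoot_iff hL (hf p.1) hσ p.2 c
  rw [hset]
  have h1 : Measurable fun p : α × EuclideanSpace ℝ (Fin 2) =>
      ((p.1, p.2 - (σ * c) • EuclideanSpace.single 0 (1 : ℝ)) : α × EuclideanSpace ℝ (Fin 2)) :=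
    measurable_fst.prodMk (measurable_snd.sub_const _)
  have h2 := hm.comp h1
  exact measurableSet_le measurable_const h2

end Literature.Barriers.AtomisticToContinuum.HardDisk

end
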